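import Mathlib
import Literature.Geometry.Lorentzian.FinalState
import Literature.Geometry.Lorentzian.CauchyDevelopment
import Literature.Geometry.Lorentzian.KerrConvergence
import Literature.Geometry.Lorentzian.KerrSchild
import HarnessLib

/-!
# HonestCore

Topic `Literature/Uncategorized`. The "honest core" hypothesis bundle `Hc` of the crux `NeckGapDecay`
(route StarvedNecks of `FinalStateConjecture`), verbatim the let-bound bundle of the crux statement, given a
name so that the registered stubs of the line skeleton (`SubwallClosureOfNoEscape`, `NoLateEscape`,
`OrientationAnchorHolds`, `GapConeCertificateHolds`) can be stated over Literature-level names only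
(the gate relocates those closed statements here, next to this file).

* `Literature.Uncategorized.HonestCore`
-/

namespace Literature.Uncategorized

open scoped Manifold ContDiff Topology ENNReal
open Filter Set MeasureTheory Topology Literature.Geometry.Lorentzian

/-- `HonestCore` = the `Hc` bundle of the crux `StarvedNecks.NeckGapDecay` (verbatim): for a `Cᵏ` final-state
decomposition `d` of `O` and a radius `R₀` — (1) sub-extremal holes, `100·Mᵢ ≤ R₀`, orthochronous boosts
`(Λᵢe₀)⁰ > 0`; (2) anchoring of hole-late points `{τ₀ < tᵢ < τ₂, rᵢ < ϱ}` in the causal past of the later disc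
`Ψᵢ{tᵢ = τ₂, rᵢ ≤ ϱ}` for every radius `ϱ ≥ R₀`; (3) relative closedness in `O` of the late tube portions
`Ψᵢ{τ' ≤ tᵢ, rᵢ ≤ ϱ(tᵢ)}` (`ϱ` continuous, `τ' > τ₀`); (4) future-oriented flat chart (`dΦ(e₀)` future-directed
after `τ₀`).  A hypothesis bundle (a predicate, not a claim). [folklore] -/
def HonestCore (𝓢 : Spacetime.{0} 4) (O : Set 𝓢.carrier) (k : ℕ) (d : FinalStateDecomposition 𝓢 O k)
    (R₀ : ℝ) : Prop :=
  let B := d.background; let t := fun i ↦ (B i).time; let r := fun i ↦ (B i).radius; let Ψ := d.chart;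
  (∀ i, Kerr.IsSubextremal (d.mass i) (d.spin i) ∧ 100 * d.mass i ≤ R₀ ∧ 0 < ((d.motion i).1 : E4 ≃L[ℝ] E4) (E4.basisVector 0) 0) ∧
    (∀ i (ϱ τ₂ : ℝ), R₀ ≤ ϱ → d.τ₀ < τ₂ → Ψ i '' {x | d.τ₀ < t i x.1 ∧ t i x.1 < τ₂ ∧ r i x.1 < ϱ} ⊆ 𝓢.metric.causalPast 𝓢.timeOrientation (Ψ i '' (B i).truncTimeSlab ϱ τ₂)) ∧
    (∀ i (τ' : ℝ) (ϱ : ℝ → ℝ), Continuous ϱ → d.τ₀ < τ' → let A := Ψ i '' {x | τ' ≤ t i x.1 ∧ r i x.1 ≤ ϱ (t i x.1)}; closure A ∩ O ⊆ A) ∧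
    (∀ y : d.flatDomain, d.τ₀ < y.1 0 → 𝓢.timeOrientation.IsFutureDirected (mfderiv 𝓘(ℝ, E4) (𝓡 4) d.flatChart y (E4.basisVector 0)))

end Literature.Uncategorized
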